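import Summits.HodgeConjecture.HodgeConjecture.Theorems.EquidimNoThinPiece
import Summits.HodgeConjecture.HodgeConjecture.Theorems.EquidimThickIffLe
import Summits.HodgeConjecture.HodgeConjecture.Theorems.UOfF
import Summits.HodgeConjecture.HodgeConjecture.Theorems.HCCMUnconditionalHDelOfFU
import Literature.AlgebraicGeometry.Dimension.SmoothRelativeDimensionOfClosedPoints
import Literature.AlgebraicGeometry.Dimension.CotangentDimensionOfOpenPiece
import Literature.AlgebraicGeometry.Limits.RelativeDimensionFieldDescent
import Literature.AlgebraicGeometry.ModuliOfAbelianVarieties.SiegelFineModuliSchemeRelDim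
import Literature.AlgebraicGeometry.Motives.AbelianVarietyProofs
import Mathlib.AlgebraicGeometry.AlgClosed.Basic
import HarnessLib

/-!
# E-road head in the tree's shape: (F) ⇒ (F′) and (F) ⇒ hDel, modulo the isogeny-quotient maps (socket (B) of the Hecke link)

Cell hodgecm-mathlib (D-0151), E-road «EQUIDIM by proof» (D-0175 (A4)(i); skeleton `Cruxes/HDel/Lines/EquidimOfF.lean` v1.2/v1.3,
B-plan1 (g14) pen), Hecke-link line card v1.1.  TREE EDITION of the skeleton's REAL glue §1–§2/§HEAD/§REG (piece currency, the
tangent count at closed points, ★ E6 + ★ field descent, the (F′) head and the hDel junction) with every stub replaced by its ★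
theorem: `stub_le` = ★ `EquidimThickIffLe.stub_le'` (Brouwer + P6), `stub_ge` = ★ `EquidimNoThinPiece.noThinPiece_of_quotientMaps₂`
(socket (A) ★, (T2) ★, (R4) ★) — so the ONLY hypothesis besides the printed citation (F) `lan2013_siegelFineModuliScheme` is the
text `hQuot` of socket (B) (sockets v6).  THEOREMS ONLY (no definition: the skeleton's carriers `MC`/`IsSection`/`pt`/`tdim` are
spelled out), `--as helper` capital for `stmt-HodgeConjecture-24835` (count-neutral).  When socket (B) is a ★ theorem `hB`,
`relDim_of_F hF := relDim_of_quotientMaps hF hB` is the sorry-free E-road head the 24835 registry v5.3 builder waits for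
(B-plan2 (g12) 2026-08-29T22:23:30Z).  HC_CM is proved only modulo the 7 printed citations until rung 0 closes.

* §1 `smooth_M_of_F`, `smooth_baseChange_M_of_F` — (F) ⇒ `𝓜.M` and `𝓜_ℂ` smooth (★ `isoOfClassify`, base change).
* §2 `finrank_cotangentSpace_eq_of_pieceBounds` — at a closed point of the smooth `ℂ`-scheme `X`, the Zariski cotangent dimension
  is `n` as soon as every smooth open piece `ι : S′ ⟶ X` of relative dimension `d` carrying a `ℂ`-point has `d ≤ n` and `n ≤ d`
  (★ `Motives.exists_opens_smoothOfRelativeDimension_of_smooth`, ★ `Dimension.finrank_cotangentSpace_stalk_eq_of_isOpenImmersion_of_isClosed'`).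
* §3 `smoothOfRelativeDimension_of_quotientMaps`, **`relDim_of_quotientMaps (hF) (hQuot) : lan2013_siegelFineModuliScheme_relDim`**,
  **`HDel_of_quotientMaps (hF) (hQuot) : Theses.HCCMUnconditional.HDel`** (★ E6 `smoothOfRelativeDimension_of_forall_isClosed_finrank_cotangentSpace_eq`,
  ★ `Limits.smoothOfRelativeDimension_hom_of_baseChangeHom_obj`, ★ `UOfF.U_of_relDim_F`, ★ `HDel_of_F_U`).

## References
* [Lan2013PELCompactifications] K.-W. Lan, *Arithmetic compactifications of PEL-type Shimura varieties* (2013), Thm. 1.4.1.11, Cor. 7.2.3.9–10.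
* [GortzWedhorn2020] U. Görtz, T. Wedhorn, *Algebraic Geometry I* (2nd ed. 2020), Prop. 6.15 (1), Thm. 6.28.
* [GortzWedhorn2023] U. Görtz, T. Wedhorn, *Algebraic Geometry II* (2023), Thm. 27.301 (p. 733).
* [MumfordFogartyKirwan1994] GIT 3rd ed., Ch. 7 §3 Thm. 7.9 (p. 139), App. 7A (p. 235).
-/

set_option autoImplicit false
set_option linter.dupNamespace false  -- `Summit.HodgeConjecture.HodgeConjecture.…` is the cell's layout (D-0017)

noncomputable section

open CategoryTheory CategoryTheory.Limits AlgebraicGeometry Topology IsLocalRing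
open Literature.AlgebraicGeometry
open Literature.AlgebraicGeometry.Motives (SchemeOver ComplexPoints AlgPoints specOver)
open Literature.AlgebraicGeometry.AbelianSchemes (PolarizedAbelianSchemeWithLevel)
open Literature.AlgebraicGeometry.ModuliOfAbelianVarieties
open Literature.AlgebraicGeometry.ModuliOfAbelianVarieties.EquidimOfF
open Literature.NumberTheory.Automorphic (siegelUpperHalfSpace)
open Literature.NumberTheory.Adeles

namespace Summit.HodgeConjecture.HodgeConjecture.Theorems

namespace EquidimRelDimOfQuotientMaps

open SiegelModuli

variable {g N : ℕ} {δ : Fin g → ℕ}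

/-! ## §1 (F) ⇒ `𝓜.M` and `𝓜_ℂ` smooth -/

/-- (F) ⇒ every carrier `𝓜` of level `N ≥ 3` has `𝓜.M → Spec ℚ` smooth (transport along ★ `isoOfClassify` from the smooth model
that (F) provides). [cite: Lan2013PELCompactifications, Thm. 1.4.1.11] [cite: MumfordFogartyKirwan1994, Ch. 7 §3 Theorem 7.9 (p. 139)] -/
theorem smooth_M_of_F (hF : lan2013_siegelFineModuliScheme) (hg : 0 < g) (hδ : IsPolarizationType δ) (hN : 3 ≤ N)
    (𝓜 : SiegelFineModuliScheme g N δ) : Smooth 𝓜.M.hom := by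
  obtain ⟨𝓜₀, hs, -, -⟩ := hF g N δ hg hδ hN
  let e : 𝓜₀.M ≅ 𝓜.M := SiegelFineModuliScheme.isoOfClassify 𝓜₀ 𝓜
  haveI : IsIso e.inv.left := by
    change IsIso ((Over.forget _).map e.inv)
    infer_instance
  haveI : Smooth 𝓜₀.M.hom := hs
  have h2 : Smooth (e.inv.left ≫ 𝓜₀.M.hom) := inferInstance
  rwa [Over.w e.inv] at h2

/-- (F) ⇒ the complex fibre `𝓜_ℂ → Spec ℂ` is smooth (base change). [cite: Lan2013PELCompactifications, Thm. 1.4.1.11] -/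
theorem smooth_baseChange_M_of_F (hF : lan2013_siegelFineModuliScheme) (hg : 0 < g) (hδ : IsPolarizationType δ)
    (hN : 3 ≤ N) (𝓜 : SiegelFineModuliScheme g N δ) : Smooth ((Motives.baseChange ℚ ℂ).obj 𝓜.M).hom := by
  change Smooth (pullback.snd 𝓜.M.hom _)
  exact MorphismProperty.pullback_snd (P := @Smooth) _ _ (smooth_M_of_F hF hg hδ hN 𝓜)

/-! ## §2 The Zariski cotangent dimension at a closed point from the two piece bounds -/

/-- **The cotangent count at a closed point of a smooth `ℂ`-scheme from bounds on its smooth open pieces**: if every open piece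
`ι : S′ ⟶ X` smooth of relative dimension `d` that carries a `ℂ`-point has `d ≤ n` and `n ≤ d`, then at every closed point `x`,
`dim_{κ(x)} 𝔪_x/𝔪_x² = n` — the closed point is a `ℂ`-point (Mathlib `pointOfClosedPoint`), it lies on an open piece smooth of
SOME relative dimension `d` (★ `Motives.exists_opens_smoothOfRelativeDimension_of_smooth`), the cotangent dimension there is `d`
(★ `Dimension.finrank_cotangentSpace_stalk_eq_of_isOpenImmersion_of_isClosed'`), and `d = n` by the two bounds.
[cite: GortzWedhorn2020, Prop. 6.15 (1) and Thm. 6.28] -/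
theorem finrank_cotangentSpace_eq_of_pieceBounds (X : SchemeOver ℂ) [Smooth X.hom] (n : ℕ)
    (hle : ∀ (S' : SchemeOver ℂ) (ι : S' ⟶ X) [IsOpenImmersion ι.left] (d : ℕ) [SmoothOfRelativeDimension d S'.hom]
      (q : Spec (CommRingCat.of ℂ) ⟶ S'.left), q ≫ S'.hom = 𝟙 _ → d ≤ n)
    (hge : ∀ (S' : SchemeOver ℂ) (ι : S' ⟶ X) [IsOpenImmersion ι.left] (d : ℕ) [SmoothOfRelativeDimension d S'.hom]
      (q : Spec (CommRingCat.of ℂ) ⟶ S'.left), q ≫ S'.hom = 𝟙 _ → n ≤ d)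
    (x : X.left) (hx : IsClosed ({x} : Set X.left)) :
    Module.finrank (ResidueField (X.left.presheaf.stalk x)) (CotangentSpace (X.left.presheaf.stalk x)) = n := by
  haveI : LocallyOfFiniteType X.hom := inferInstance
  -- the `ℂ`-point under `x` and an open piece of pure relative dimension through it
  let p : Spec (CommRingCat.of ℂ) ⟶ X.left := pointOfClosedPoint X.hom x hx
  have hp : p ≫ X.hom = 𝟙 _ := pointOfClosedPoint_comp X.hom x hx
  have hpx : p.base (closedPoint ℂ) = x := pointOfClosedPoint_apply X.hom x hx _
  obtain ⟨V, d, hxV, hV⟩ := Literature.AlgebraicGeometry.Motives.exists_opens_smoothOfRelativeDimension_of_smooth X.hom x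
  let S' : SchemeOver ℂ := Over.mk (V.ι ≫ X.hom)
  let ι : S' ⟶ X := Over.homMk V.ι rfl
  haveI hι : IsOpenImmersion ι.left := by
    change AlgebraicGeometry.IsOpenImmersion V.ι
    infer_instance
  haveI hd : SmoothOfRelativeDimension d S'.hom := hV
  haveI : SmoothOfRelativeDimension d (ι.left ≫ X.hom) := hV
  -- the lift of `p` through `V` (its image is the point `x ∈ V`)
  have hrange : Set.range p.base ⊆ Set.range V.ι.base := by
    rw [Scheme.Opens.range_ι]
    haveI : Unique ↥(Spec (CommRingCat.of ℂ)) := inferInstanceAs (Unique (PrimeSpectrum ℂ))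
    rintro _ ⟨z, rfl⟩
    rw [Subsingleton.elim z (closedPoint ℂ), hpx]
    exact hxV
  let q : Spec (CommRingCat.of ℂ) ⟶ (V : Scheme) := IsOpenImmersion.lift V.ι p hrange
  have hq : q ≫ V.ι = p := IsOpenImmersion.lift_fac V.ι p hrange
  have hqS : q ≫ S'.hom = 𝟙 _ := by
    change q ≫ (V.ι ≫ X.hom) = 𝟙 _
    rw [← Category.assoc, hq, hp]
  have hy : IsClosed ({q.base (closedPoint ℂ)} : Set S'.left) := by
    have := (pointEquivClosedPoint S'.hom ⟨q, hqS⟩).2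
    rw [pointEquivClosedPoint_apply_coe, mem_closedPoints_iff] at this
    exact this
  have hxq : x = ι.left.base (q.base (closedPoint ℂ)) := by
    rw [← hpx, ← hq]; rfl
  -- the count on the piece, and `d = n`
  have hdn : d = n := le_antisymm (hle S' ι d q hqS) (hge S' ι d q hqS)
  rw [hxq, Literature.AlgebraicGeometry.Dimension.finrank_cotangentSpace_stalk_eq_of_isOpenImmersion_of_isClosed'
    X.hom ι.left d hy, hdn]

/-! ## §3 (F) ⇒ (F′) and (F) ⇒ hDel, modulo socket (B) -/

/-- **EQUIDIM from (F) and the isogeny-quotient maps**: `𝓜.M → Spec ℚ` is smooth of relative dimension `g(g+1)/2` for every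
carrier — at every closed point of `𝓜_ℂ` the cotangent count is `g(g+1)/2` by §2 with `stub_le` = ★ `EquidimThickIffLe.stub_le'`
and `stub_ge` = ★ `EquidimNoThinPiece.noThinPiece_of_quotientMaps₂ hF hQuot`; then ★ E6 over `ℂ` and ★ field descent `ℂ/ℚ`.
[cite: GortzWedhorn2020, Prop. 6.15 (1) and Thm. 6.28] [cite: GortzWedhorn2023, Thm. 27.301 (p. 733)] -/
theorem smoothOfRelativeDimension_of_quotientMaps (hF : lan2013_siegelFineModuliScheme)
    (hQuot : ∀ (_hF : lan2013_siegelFineModuliScheme) (g N N' : ℕ) (δ δ' : Fin g → ℕ) (_hg : 0 < g)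
      (hδ : IsPolarizationType δ) (_hN : 3 ≤ N) (hδ' : IsPolarizationType δ')
      (𝓜 : SiegelFineModuliScheme g N δ) (𝓜' : SiegelFineModuliScheme g N' δ')
      (S'' : SchemeOver ℂ) (ι' : S'' ⟶ (Motives.baseChange ℚ ℂ).obj 𝓜'.M)
      (d'' : ℕ) [SmoothOfRelativeDimension d'' S''.hom] (r' : gspFinAdelic δ') (_ : r' ∈ principalLevelSubgroup δ' 1)
      (s' : ComplexPoints S'') (_ : IsThickAtWith hδ' 𝓜' ι' d'' s' r')
      (x : ComplexPoints ((Motives.baseChange ℚ ℂ).obj 𝓜.M)),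
      HeckeLinked 𝓜 𝓜' r' (AlgPoints.map (L := ℂ) ι' s') x → Odd (N' / N) →
      haveI : IsLocallyNoetherian (specOver ℚ ℂ).left := inferInstanceAs (IsLocallyNoetherian (Spec (CommRingCat.of ℂ)))
      ∃ (Φ : ComplexPoints S'' → ComplexPoints ((Motives.baseChange ℚ ℂ).obj 𝓜.M)) (_ : Continuous Φ) (_ : Φ s' = x)
        (θ : siegelUpperHalfSpace g → siegelUpperHalfSpace g) (_ : IsOpenMap θ)
        (r : gspFinAdelic δ) (_ : r ∈ principalLevelSubgroup δ 1),
        ∀ (s : ComplexPoints S'') (Z : siegelUpperHalfSpace g)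
          (P' : PolarizedAbelianSchemeWithLevel g N' δ' (specOver ℚ ℂ).left),
          IsAdmissibleAt hδ' r' Z.1 Z.2 P' →
          AlgPoints.baseChangeEquiv (algebraMap ℚ ℂ) 𝓜'.M (𝓜'.classifyingMap (specOver ℚ ℂ) P') =
            AlgPoints.map (L := ℂ) ι' s →
          ∃ P : PolarizedAbelianSchemeWithLevel g N δ (specOver ℚ ℂ).left,
            IsAdmissibleAt hδ r (θ Z).1 (θ Z).2 P ∧
            AlgPoints.baseChangeEquiv (algebraMap ℚ ℂ) 𝓜.M (𝓜.classifyingMap (specOver ℚ ℂ) P) = Φ s)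
    (hg : 0 < g) (hδ : IsPolarizationType δ) (hN : 3 ≤ N) (𝓜 : SiegelFineModuliScheme g N δ) :
    SmoothOfRelativeDimension (g * (g + 1) / 2) 𝓜.M.hom := by
  haveI : Smooth ((Motives.baseChange ℚ ℂ).obj 𝓜.M).hom := smooth_baseChange_M_of_F hF hg hδ hN 𝓜
  haveI : SmoothOfRelativeDimension (g * (g + 1) / 2) ((Motives.baseChangeHom (algebraMap ℚ ℂ)).obj 𝓜.M).hom :=
    Literature.AlgebraicGeometry.Dimension.smoothOfRelativeDimension_of_forall_isClosed_finrank_cotangentSpace_eq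
      ((Motives.baseChange ℚ ℂ).obj 𝓜.M).hom _
      (finrank_cotangentSpace_eq_of_pieceBounds ((Motives.baseChange ℚ ℂ).obj 𝓜.M) (g * (g + 1) / 2)
        (fun S' ι _ d _ q hq ↦ EquidimThickIffLe.stub_le' hF hg hδ hN 𝓜 S' ι d q hq)
        (fun S' ι _ d _ q hq ↦ EquidimNoThinPiece.noThinPiece_of_quotientMaps₂ hF hQuot N δ hg hδ hN 𝓜 S' ι d q hq))
  exact Literature.AlgebraicGeometry.Limits.smoothOfRelativeDimension_hom_of_baseChangeHom_obj (algebraMap ℚ ℂ) _ 𝓜.M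

/-- **THE E-ROAD HEAD, modulo socket (B): (F) ⇒ (F′)** (`lan2013_siegelFineModuliScheme_relDim`, ★ p737414's statement = (F) ∧ the
relative dimension `g(g+1)/2`), REAL over ★ (E1)/(E3) given the text `hQuot` of the isogeny-quotient maps.  With socket (B) a ★
theorem `hB`, `relDim_of_quotientMaps hF hB` is the sorry-free E-road head.
[cite: Lan2013PELCompactifications, Thm. 1.4.1.11] [cite: GortzWedhorn2023, Thm. 27.301 (p. 733)] -/
theorem relDim_of_quotientMaps (hF : lan2013_siegelFineModuliScheme)
    (hQuot : ∀ (_hF : lan2013_siegelFineModuliScheme) (g N N' : ℕ) (δ δ' : Fin g → ℕ) (_hg : 0 < g)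
      (hδ : IsPolarizationType δ) (_hN : 3 ≤ N) (hδ' : IsPolarizationType δ')
      (𝓜 : SiegelFineModuliScheme g N δ) (𝓜' : SiegelFineModuliScheme g N' δ')
      (S'' : SchemeOver ℂ) (ι' : S'' ⟶ (Motives.baseChange ℚ ℂ).obj 𝓜'.M)
      (d'' : ℕ) [SmoothOfRelativeDimension d'' S''.hom] (r' : gspFinAdelic δ') (_ : r' ∈ principalLevelSubgroup δ' 1)
      (s' : ComplexPoints S'') (_ : IsThickAtWith hδ' 𝓜' ι' d'' s' r')
      (x : ComplexPoints ((Motives.baseChange ℚ ℂ).obj 𝓜.M)),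
      HeckeLinked 𝓜 𝓜' r' (AlgPoints.map (L := ℂ) ι' s') x → Odd (N' / N) →
      haveI : IsLocallyNoetherian (specOver ℚ ℂ).left := inferInstanceAs (IsLocallyNoetherian (Spec (CommRingCat.of ℂ)))
      ∃ (Φ : ComplexPoints S'' → ComplexPoints ((Motives.baseChange ℚ ℂ).obj 𝓜.M)) (_ : Continuous Φ) (_ : Φ s' = x)
        (θ : siegelUpperHalfSpace g → siegelUpperHalfSpace g) (_ : IsOpenMap θ)
        (r : gspFinAdelic δ) (_ : r ∈ principalLevelSubgroup δ 1),
        ∀ (s : ComplexPoints S'') (Z : siegelUpperHalfSpace g)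
          (P' : PolarizedAbelianSchemeWithLevel g N' δ' (specOver ℚ ℂ).left),
          IsAdmissibleAt hδ' r' Z.1 Z.2 P' →
          AlgPoints.baseChangeEquiv (algebraMap ℚ ℂ) 𝓜'.M (𝓜'.classifyingMap (specOver ℚ ℂ) P') =
            AlgPoints.map (L := ℂ) ι' s →
          ∃ P : PolarizedAbelianSchemeWithLevel g N δ (specOver ℚ ℂ).left,
            IsAdmissibleAt hδ r (θ Z).1 (θ Z).2 P ∧
            AlgPoints.baseChangeEquiv (algebraMap ℚ ℂ) 𝓜.M (𝓜.classifyingMap (specOver ℚ ℂ) P) = Φ s) :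
    lan2013_siegelFineModuliScheme_relDim := by
  intro g N δ hg hδ hN
  obtain ⟨𝓜, hs, hq, hX⟩ := hF g N δ hg hδ hN
  exact ⟨𝓜, hs, hq, hX, smoothOfRelativeDimension_of_quotientMaps hF (fun hF' g ↦ hQuot hF' g) hg hδ hN 𝓜⟩

/-- **THE hDel JUNCTION, modulo socket (B): (F) ⇒ hDel** — ★ `HDel_of_F_U` fed by (F) and (U) := ★ `UOfF.U_of_relDim_F` of the
head; concludes `Summit.HodgeConjecture.HodgeConjecture.Theses.HCCMUnconditional.HDel` BY NAME from the printed citation (F) and the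
text of socket (B). [cite: Lan2013PELCompactifications, Thm. 1.4.1.11 and Cor. 7.2.3.9–7.2.3.10] -/
theorem HDel_of_quotientMaps (hF : lan2013_siegelFineModuliScheme)
    (hQuot : ∀ (_hF : lan2013_siegelFineModuliScheme) (g N N' : ℕ) (δ δ' : Fin g → ℕ) (_hg : 0 < g)
      (hδ : IsPolarizationType δ) (_hN : 3 ≤ N) (hδ' : IsPolarizationType δ')
      (𝓜 : SiegelFineModuliScheme g N δ) (𝓜' : SiegelFineModuliScheme g N' δ')
      (S'' : SchemeOver ℂ) (ι' : S'' ⟶ (Motives.baseChange ℚ ℂ).obj 𝓜'.M)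
      (d'' : ℕ) [SmoothOfRelativeDimension d'' S''.hom] (r' : gspFinAdelic δ') (_ : r' ∈ principalLevelSubgroup δ' 1)
      (s' : ComplexPoints S'') (_ : IsThickAtWith hδ' 𝓜' ι' d'' s' r')
      (x : ComplexPoints ((Motives.baseChange ℚ ℂ).obj 𝓜.M)),
      HeckeLinked 𝓜 𝓜' r' (AlgPoints.map (L := ℂ) ι' s') x → Odd (N' / N) →
      haveI : IsLocallyNoetherian (specOver ℚ ℂ).left := inferInstanceAs (IsLocallyNoetherian (Spec (CommRingCat.of ℂ)))
      ∃ (Φ : ComplexPoints S'' → ComplexPoints ((Motives.baseChange ℚ ℂ).obj 𝓜.M)) (_ : Continuous Φ) (_ : Φ s' = x)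
        (θ : siegelUpperHalfSpace g → siegelUpperHalfSpace g) (_ : IsOpenMap θ)
        (r : gspFinAdelic δ) (_ : r ∈ principalLevelSubgroup δ 1),
        ∀ (s : ComplexPoints S'') (Z : siegelUpperHalfSpace g)
          (P' : PolarizedAbelianSchemeWithLevel g N' δ' (specOver ℚ ℂ).left),
          IsAdmissibleAt hδ' r' Z.1 Z.2 P' →
          AlgPoints.baseChangeEquiv (algebraMap ℚ ℂ) 𝓜'.M (𝓜'.classifyingMap (specOver ℚ ℂ) P') =
            AlgPoints.map (L := ℂ) ι' s →
          ∃ P : PolarizedAbelianSchemeWithLevel g N δ (specOver ℚ ℂ).left,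
            IsAdmissibleAt hδ r (θ Z).1 (θ Z).2 P ∧
            AlgPoints.baseChangeEquiv (algebraMap ℚ ℂ) 𝓜.M (𝓜.classifyingMap (specOver ℚ ℂ) P) = Φ s) :
    Summit.HodgeConjecture.HodgeConjecture.Theses.HCCMUnconditional.HDel :=
  HDel_of_F_U hF (UOfF.U_of_relDim_F (relDim_of_quotientMaps hF hQuot))

end EquidimRelDimOfQuotientMaps

end Summit.HodgeConjecture.HodgeConjecture.Theorems

end
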